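import Summits.HodgeConjecture.HodgeConjecture.Theorems.R90S9TestPairPins                  -- ★ p862626 (p05): `tensOfPair`, `isKcBiInv_tensOfPair`; cone ★ p862596, ★ p862412 `tupleOf`
import Summits.HodgeConjecture.HodgeConjecture.Theorems.R90S9InnerFormSec146Datum          -- ★ p862404 (p01): `DatumInputs`, `gammaSph`
import HarnessLib

/-!
# R90-TF · S9 «InnerForm-13.3.6 (c)» — (ε1‴) THE DATUM-INPUTS TERM OF RECORD `X_cm` OVER THE BARE TEST PAIRS, WITH THE TEST-SIDE PINS OF RULINGS S9-R-TG-4 ∕ TG-5 AND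
# THE J8 PINS (R90-IF-plan (g2) 23:00:27Z (n1″) ∕ 23:09:40Z (ε1) v2 spec; Rogawski 1990 §14.5 p. 237, §14.6 pp. 241–245)

Cell `hodgecm-mathlib`, crux H413 (`stmt-HodgeConjecture-24833`, lane `--supports … --as helper`), route of record `HCCMUnconditional` (count-neutral).  Programme R90-TF,
section S9 (base `R90-IF`); seat R90-IF-p05 (g0); deal (4″)→(ε1) v2 of R90-IF-plan (g2) (R90 bus 23:09:40Z: the HOME block `Xcm-block.v1.lean` 9f018e18 «=» + four deltas
(a) `G`, `finOfG` PARAMETERS ⇒ `Lines`-free ⇒ a ★ Theorems file, (b) TG-5 `TransferH_cm := Smooth_cm ∧ …`, (c) the J8 pins `PSVanish_cm` ∕ `PSVanishH_cm` ∕ `MatchH_cm` + the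
dischargers `hvan_cm` ∕ `hvanH_cm`, (d) `νinf` a PARAMETER).  DEFINITIONS + `rfl` laws (`--kind definition`, review lane); no instance, no notation, no named fact, no `sorry`;
never imports a `Cruxes/…/Lines` module; namespace `Summit.HodgeConjecture.HodgeConjecture.R90.S9`.
HONEST LABEL: HC_CM is proved only modulo the 7 printed citations (2 remaining named inputs: hLiu418 = stmt-HodgeConjecture-24832, h413 = stmt-HodgeConjecture-24833)
— until rung 0 closes.  Bookkeeping term; proves no printed statement.

## WHAT IS PINNED AND WHAT IS PASSED THROUGH
`X_cm … : InnerFormSec146.DatumInputs ‹bare pair› (TestG L) (TestH L) L ι H T hT μA Ξ 𝔩` (★ p862404), the bare pair type being ★ p862002's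
`(G′_∞ → ℂ) × (∀ v, G′_v → ℂ)` (RULING S9-R-TG).  PINNED (S9-owned, (n1)): `traceL := fun p => θG (tensOfPair L H ι T hT p)` (★ p862596; `θG := ⇑𝔨.traceGp` at B §0 — a
parameter here so the term does not depend on the kit row's spelling) and `trPrime := fun π′ p => Θ₀ (tupleOf … π′) p := archTr₀ … νinf (tupleOf π′).1 p.1 · ∏ᶠ_v tr ((tupleOf π′).2 v)(p.2 v)`
(★ p862240 §1 at ★ p862412 `tupleOf`; Haar data `νinf`, `μv` PARAMETERS — RULING νinf 23:09:40Z: B's head obtains `νinf` from `sock_S9_productHaar_cm`).  PASSED THROUGH BY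
NAME (parameters of the same names, typed over the parameter `G : GlobalPacketData (TestG L) (TestH L)`): `G` (:= S5-C2 `gOfRecord …` at B), `finOfG` (:= `fun Q => Q.1.fin` at B),
`tr trH IsOneDim IsOneDimH oneDimOf AllPkt ofDisc trAll IsL2At trPPrime psi' MnNeZero` (S5 ∕ S2 ∕ S10 owners; `MnNeZero` in S2's D7 COH-TRIVIAL reading), and the off-path
ρ-side fields `LiftL2At PiRho' sgn' HasPinComponent`.  READ-BACKS (`rfl`): `X_cm_G`, `X_cm_finOfG`, `X_cm_traceL`, **`htrX_cm`** (the `htrX` hypothesis of ★ p862518 ∕ p862626 ∕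
p862763 and of the pay line (δ6b) ★ p862810-lineage at `X := X_cm`).
TEST-SIDE PINS (generic in the kit's predicates `Smooth : TestGp L H → Prop`, `Transfer : TestGp L H → TestG L → Prop`, `TransferH : TestGp L H → TestH L → Prop`):
`Smooth_cm p := 𝓕₀ p ∧ Smooth (tensOfPair p)` (TG-4), `Transfer_cm p f := IsKcBiInv (tensOfPair p) ∧ Transfer (tensOfPair p) f` (TG-4; guard free for every `p`, ★ p862626
`isKcBiInv_tensOfPair` — `transfer_cm_iff`), `TransferH_cm p fH := Smooth_cm p ∧ TransferH (tensOfPair p) fH` (TG-5); J8 PINS `PSVanish_cm f := ∃ p, Smooth_cm p ∧ Transfer_cm p f`,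
`PSVanishH_cm fH := ∃ p, TransferH_cm p fH`, `MatchH_cm f fH := ∃ p, Smooth_cm p ∧ Transfer_cm p f ∧ TransferH_cm p fH`, with the one-line dischargers `hvan_cm`, `hvanH_cm`
(the `hvan` ∕ `hvanH` binders of (δ6b) at these pins).
[cite: Rogawski1990, §14.5 p. 237; §14.6 pp. 241–245; §14.2 p. 233] [cite: BorelJacquet1979, §4.1 and §4.6]
-/

set_option autoImplicit false
-- the mandated namespace repeats `HodgeConjecture.HodgeConjecture`, as in every `Theorems/*.lean` of this sub-problem
set_option linter.dupNamespace false

noncomputable section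

open NumberField IsDedekindDomain MeasureTheory Filter
open scoped Matrix MatrixGroups Classical
open Literature.NumberTheory Literature.NumberTheory.Automorphic Literature.NumberTheory.Automorphic.UnitaryGroup
open Literature.NumberTheory.Automorphic.UnitaryGroup.CotangentForms
open Literature.NumberTheory.Rogawski1990 Literature.NumberTheory.GaloisRepresentations
open Summit.HodgeConjecture.HodgeConjecture.Cruxes.H413
open Summit.HodgeConjecture.HodgeConjecture.Cruxes.H413.F0P3LocalPacketKit
open Summit.HodgeConjecture.HodgeConjecture.Cruxes.H413.F0P3GlobalPacket
open Summit.HodgeConjecture.HodgeConjecture.Cruxes.H413.F0P3GlobalPacketDiscrete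
open Summit.HodgeConjecture.HodgeConjecture.Cruxes.H413.F0P3InnerFormClassificationV6 (TestG TestH TestGp splitForm Places)
open Summit.HodgeConjecture.HodgeConjecture.R90.S9.InnerFormSec146

namespace Summit.HodgeConjecture.HodgeConjecture.R90.S9

section DatumOfRecordCM

variable (L : Type) [Field L] [NumberField L] [IsCMField L] (ι : L →+* ℂ) (H : Matrix (Fin 3) (Fin 3) L) (T : GL (Fin 3) ℂ)
  (hT : (T : Matrix (Fin 3) (Fin 3) ℂ)ᴴ * H.map ι * (T : Matrix (Fin 3) (Fin 3) ℂ) = Literature.Geometry.ComplexHyperbolic.BallModel.J)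
  (μA : Measure (adelicGroupData (↥(maximalRealSubfield L)) L (IsCMField.complexConj L) 3 H).automorphicQuotient)
  [(adelicGroupData (↥(maximalRealSubfield L)) L (IsCMField.complexConj L) 3 H).IsAutomorphicMeasure μA]
  (Ξ : OneDimAutRepH L → PacketPrimeFin L H)
  {H' : Matrix (Fin 3) (Fin 3) L} (𝔩 : ∀ v : HeightOneSpectrum (𝓞 ↥(maximalRealSubfield L)), LocalPacketKit L H' v)
  -- the `G`-side packet datum (:= S5-C2 `gOfRecord …` at B §0) and its finite-part reader (:= `fun Q => Q.1.fin` at B §0)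
  (G : GlobalPacketData.{0} (TestG L) (TestH L)) (finOfG : G.Packet → GlobalPacket 𝔩)
  -- S9 test-side data: `θ_{G′}` as a functional on `TestGp` (`⇑𝔨.traceGp` at B), the Haar data of ★ p862002's characters
  (θG : TestGp L H → ℂ)
  (νinf : @Measure (UnitaryGroup.arch (↥(maximalRealSubfield L)) L (IsCMField.complexConj L) 3 H) (borel _))
  (μv : ∀ v : Places L, @Measure ((cmDatum L 3 H).Local v) (borel _))
  -- OWED fields (S5 ∕ S2 ∕ off-path), passed through
  (tr : G.Rep → TestG L → ℂ)
  (trH : G.PacketH → TestH L → ℂ)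
  (IsOneDim : G.Packet → Prop)
  (IsOneDimH : G.PacketH → Prop)
  (oneDimOf : (ρ : G.PacketH) → IsOneDimH ρ → OneDimAutRepH L)
  (AllPkt : Type) (ofDisc : G.Packet → AllPkt) (trAll : AllPkt → TestG L → ℂ)
  (IsL2At : G.Packet → InnerFormSec146.Place L → Prop)
  (trPPrime : PacketPrime L H μA Ξ →
    (UnitaryGroup.arch (↥(maximalRealSubfield L)) L (IsCMField.complexConj L) 3 H → ℂ) × (∀ v : Places L, (cmDatum L 3 H).Local v → ℂ) → ℂ)
  (psi' : PacketPrime L H μA Ξ → AllPkt)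
  (MnNeZero : G.PacketH → InnerFormSec146.Place L → Prop)
  (LiftL2At : G.PacketH → InnerFormSec146.Place L → Prop)
  (PiRho' : (ρ : G.PacketH) → (∀ p : InnerFormSec146.Place L, p ∈ InnerFormSec146.S0 L H → LiftL2At ρ p) → PacketPrime L H μA Ξ)
  (sgn' : Option G.PacketH → RepPrimeSph L ι H T hT μA → ℤ)
  (HasPinComponent : RepPrimeSph L ι H T hT μA → Prop)

/-- **`X_cm` — the §14.6 datum inputs OF RECORD for the CM inner form, over the BARE test-pair type** ((n1), RULINGS S9-R-TG ∕ TG-4): `G` (:= S5-C2 `gOfRecord …` at B §0),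
`finOfG` (:= `fun Q => Q.1.fin` at B §0), `traceL p := θ_{G′}(tensOfPair p)`, `trPrime π′ p := Θ₀ (tupleOf π′) p := archTr₀ (tupleOf π′).1 p.1 · ∏ᶠ_v tr ((tupleOf π′).2 v)(p.2 v)`; the S5 ∕ S2 ∕
off-path fields and the `G`-side datum are the parameters of the same names. [cite: Rogawski1990, §14.5 p. 237; §14.6 pp. 241–245] -/
def X_cm : DatumInputs
    ((UnitaryGroup.arch (↥(maximalRealSubfield L)) L (IsCMField.complexConj L) 3 H → ℂ) × (∀ v : Places L, (cmDatum L 3 H).Local v → ℂ))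
    (TestG L) (TestH L) L ι H T hT μA Ξ 𝔩 where
  G := G
  tr := tr
  trH := trH
  IsOneDim := IsOneDim
  IsOneDimH := IsOneDimH
  oneDimOf := oneDimOf
  AllPkt := AllPkt
  ofDisc := ofDisc
  trAll := trAll
  IsL2At := IsL2At
  finOfG := finOfG
  trPrime := fun π' p => UnitaryGroup.archTr₀ L ι H T hT νinf (tupleOf L ι H T hT μA π').1 p.1 *
    ∏ᶠ v : Places L, (letI : MeasurableSpace ((cmDatum L 3 H).Local v) := borel _;
      ((tupleOf L ι H T hT μA π').2 v).smoothTrace (μv v) (p.2 v))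
  trPPrime := trPPrime
  traceL := fun p => θG (tensOfPair L H ι T hT p)
  psi' := psi'
  MnNeZero := MnNeZero
  LiftL2At := LiftL2At
  PiRho' := PiRho'
  sgn' := sgn'
  HasPinComponent := HasPinComponent

/-- `X_cm.G = G` (the parameter; `:= gOfRecord …` at B §0) (`rfl`). [cite: Rogawski1990, §13.3 p. 201] -/
theorem X_cm_G : (X_cm L ι H T hT μA Ξ 𝔩 G finOfG θG νinf μv tr trH IsOneDim IsOneDimH oneDimOf AllPkt ofDisc trAll IsL2At trPPrime psi' MnNeZero
    LiftL2At PiRho' sgn' HasPinComponent).G = G := rfl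

/-- `X_cm.finOfG = finOfG` (the parameter; `:= fun Q => Q.1.fin` at B §0) (`rfl`). [cite: Rogawski1990, §13.3 p. 201] -/
theorem X_cm_finOfG (Q : G.Packet) :
    (X_cm L ι H T hT μA Ξ 𝔩 G finOfG θG νinf μv tr trH IsOneDim IsOneDimH oneDimOf AllPkt ofDisc trAll IsL2At trPPrime psi' MnNeZero
      LiftL2At PiRho' sgn' HasPinComponent).finOfG Q = finOfG Q := rfl

/-- `X_cm.traceL p = θ_{G′}(tensOfPair p)` (`rfl`). [cite: Rogawski1990, §14.5 p. 237] -/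
theorem X_cm_traceL (p : (UnitaryGroup.arch (↥(maximalRealSubfield L)) L (IsCMField.complexConj L) 3 H → ℂ) × (∀ v : Places L, (cmDatum L 3 H).Local v → ℂ)) :
    (X_cm L ι H T hT μA Ξ 𝔩 G finOfG θG νinf μv tr trH IsOneDim IsOneDimH oneDimOf AllPkt ofDisc trAll IsL2At trPPrime psi' MnNeZero
      LiftL2At PiRho' sgn' HasPinComponent).traceL p = θG (tensOfPair L H ι T hT p) := rfl

/-- **`htrX_cm`** — `X_cm.trPrime π′ p = Θ₀ (tupleOf π′) p` (`rfl`): the `htrX` hypothesis of ★ p862518 ∕ p862626 ∕ p862763 and of the (δ5)∕(δ6a) pay line at `X := X_cm`. [cite: Rogawski1990, §14.5 p. 237; §14.6 p. 244] -/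
theorem htrX_cm (π' : RepPrimeSph L ι H T hT μA)
    (p : (UnitaryGroup.arch (↥(maximalRealSubfield L)) L (IsCMField.complexConj L) 3 H → ℂ) × (∀ v : Places L, (cmDatum L 3 H).Local v → ℂ)) :
    (X_cm L ι H T hT μA Ξ 𝔩 G finOfG θG νinf μv tr trH IsOneDim IsOneDimH oneDimOf AllPkt ofDisc trAll IsL2At trPPrime psi' MnNeZero
      LiftL2At PiRho' sgn' HasPinComponent).trPrime π' p =
      UnitaryGroup.archTr₀ L ι H T hT νinf (tupleOf L ι H T hT μA π').1 p.1 *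
        ∏ᶠ v : Places L, (letI : MeasurableSpace ((cmDatum L 3 H).Local v) := borel _;
          ((tupleOf L ι H T hT μA π').2 v).smoothTrace (μv v) (p.2 v)) := rfl

/-! ### The test-side pins of RULINGS S9-R-TG-4 ∕ TG-5 and the J8 pins (generic in the kit's predicates on `TestGp`) -/

variable (Smooth : TestGp L H → Prop) (Transfer : TestGp L H → TestG L → Prop) (TransferH : TestGp L H → TestH L → Prop)

/-- **`Smooth_cm p := 𝓕₀ p ∧ Smooth (tensOfPair p)`** (TG-4) — the test predicate `𝓕₀` of ★ p862002 ∕ p862240 §1 (units `𝟙_{K_v}`) kept as the first conjunct, the handle every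
discharge needs. [cite: Rogawski1990, §14.2 p. 233] [cite: BorelJacquet1979, §4.1] -/
def Smooth_cm (p : (UnitaryGroup.arch (↥(maximalRealSubfield L)) L (IsCMField.complexConj L) 3 H → ℂ) × (∀ v : Places L, (cmDatum L 3 H).Local v → ℂ)) : Prop :=
  (ArchTestKc L ι H T hT p.1 ∧ (∀ v : Places L, IsLocallyConstant (p.2 v) ∧ HasCompactSupport (p.2 v)) ∧
      {v : Places L | p.2 v ≠ (cmLocalIntegralLevel L 3 H v : Set ((cmDatum L 3 H).Local v)).indicator fun _ => (1 : ℂ)}.Finite) ∧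
    Smooth (tensOfPair L H ι T hT p)

/-- **`Transfer_cm p f := IsKcBiInv (tensOfPair p) ∧ Transfer (tensOfPair p) f`** (TG-4: the S9-R-b′ guard + the kit's transfer at the realised test).
[cite: Rogawski1990, §14.2 p. 233; §14.6 p. 244] [cite: BorelJacquet1979, §4.6] -/
def Transfer_cm (p : (UnitaryGroup.arch (↥(maximalRealSubfield L)) L (IsCMField.complexConj L) 3 H → ℂ) × (∀ v : Places L, (cmDatum L 3 H).Local v → ℂ))
    (f : TestG L) : Prop :=
  IsKcBiInv L ι H T hT (tensOfPair L H ι T hT p) ∧ Transfer (tensOfPair L H ι T hT p) f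

/-- **`TransferH_cm p fH := Smooth_cm p ∧ TransferH (tensOfPair p) fH`** (TG-5, R90-IF-plan (g2) 23:05:56Z). [cite: Rogawski1990, §14.2 p. 233; §4.9] -/
def TransferH_cm (p : (UnitaryGroup.arch (↥(maximalRealSubfield L)) L (IsCMField.complexConj L) 3 H → ℂ) × (∀ v : Places L, (cmDatum L 3 H).Local v → ℂ))
    (fH : TestH L) : Prop :=
  Smooth_cm L ι H T hT Smooth p ∧ TransferH (tensOfPair L H ι T hT p) fH

/-- **The guard conjunct of `Transfer_cm` holds for EVERY `p`** (★ p862626 `isKcBiInv_tensOfPair`): `Transfer_cm p f ↔ Transfer (tensOfPair p) f`.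
[cite: Rogawski1990, §14.6 p. 244] [cite: BorelJacquet1979, §4.6] -/
theorem transfer_cm_iff (p : (UnitaryGroup.arch (↥(maximalRealSubfield L)) L (IsCMField.complexConj L) 3 H → ℂ) × (∀ v : Places L, (cmDatum L 3 H).Local v → ℂ))
    (f : TestG L) : Transfer_cm L ι H T hT Transfer p f ↔ Transfer (tensOfPair L H ι T hT p) f :=
  ⟨fun h => h.2, fun h => ⟨isKcBiInv_tensOfPair L H ι T hT p, h⟩⟩

/-- **J8 pin `PSVanish_cm f := ∃ p, Smooth_cm p ∧ Transfer_cm p f`** — «`f` on `G = U(Φ₃)` is the transfer of some guarded pure tensor `f′` on `G′`» (the vanishing-class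
predicate the (S5∕S8) block of the pay line is read on). [cite: Rogawski1990, §14.6 p. 241 (14.6.1); §14.2 p. 233] -/
def PSVanish_cm (f : TestG L) : Prop :=
  ∃ p : (UnitaryGroup.arch (↥(maximalRealSubfield L)) L (IsCMField.complexConj L) 3 H → ℂ) × (∀ v : Places L, (cmDatum L 3 H).Local v → ℂ),
    Smooth_cm L ι H T hT Smooth p ∧ Transfer_cm L ι H T hT Transfer p f

/-- **J8 pin `PSVanishH_cm fH := ∃ p, TransferH_cm p fH`**. [cite: Rogawski1990, §14.6 p. 241 (14.6.1); §4.9] -/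
def PSVanishH_cm (fH : TestH L) : Prop :=
  ∃ p : (UnitaryGroup.arch (↥(maximalRealSubfield L)) L (IsCMField.complexConj L) 3 H → ℂ) × (∀ v : Places L, (cmDatum L 3 H).Local v → ℂ),
    TransferH_cm L ι H T hT Smooth TransferH p fH

/-- **J8 pin `MatchH_cm f fH := ∃ p, Smooth_cm p ∧ Transfer_cm p f ∧ TransferH_cm p fH`** — `f` and `f^H` are transfers of ONE guarded `f′`. [cite: Rogawski1990, §14.6 p. 241 (14.6.1); §4.9] -/
def MatchH_cm (f : TestG L) (fH : TestH L) : Prop :=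
  ∃ p : (UnitaryGroup.arch (↥(maximalRealSubfield L)) L (IsCMField.complexConj L) 3 H → ℂ) × (∀ v : Places L, (cmDatum L 3 H).Local v → ℂ),
    Smooth_cm L ι H T hT Smooth p ∧ Transfer_cm L ι H T hT Transfer p f ∧ TransferH_cm L ι H T hT Smooth TransferH p fH

/-- **`hvan_cm`** — the `hvan` binder of the pay line at these pins: a guarded transfer pair witnesses `PSVanish_cm`. [cite: Rogawski1990, §14.6 p. 241] -/
theorem hvan_cm (p : (UnitaryGroup.arch (↥(maximalRealSubfield L)) L (IsCMField.complexConj L) 3 H → ℂ) × (∀ v : Places L, (cmDatum L 3 H).Local v → ℂ))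
    (f : TestG L) (h : Smooth_cm L ι H T hT Smooth p ∧ Transfer_cm L ι H T hT Transfer p f) : PSVanish_cm L ι H T hT Smooth Transfer f :=
  ⟨p, h⟩

/-- **`hvanH_cm`** — the `hvanH` binder of the pay line at these pins. [cite: Rogawski1990, §14.6 p. 241] -/
theorem hvanH_cm (p : (UnitaryGroup.arch (↥(maximalRealSubfield L)) L (IsCMField.complexConj L) 3 H → ℂ) × (∀ v : Places L, (cmDatum L 3 H).Local v → ℂ))
    (fH : TestH L) (h : TransferH_cm L ι H T hT Smooth TransferH p fH) : PSVanishH_cm L ι H T hT Smooth TransferH fH :=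
  ⟨p, h⟩

/-- **`matchH_cm_intro`** — one guarded `f′` transferring to `f` and to `f^H` witnesses `MatchH_cm f fH` (the `hexH`-side constructor). [cite: Rogawski1990, §14.6 p. 241] -/
theorem matchH_cm_intro (p : (UnitaryGroup.arch (↥(maximalRealSubfield L)) L (IsCMField.complexConj L) 3 H → ℂ) × (∀ v : Places L, (cmDatum L 3 H).Local v → ℂ))
    (f : TestG L) (fH : TestH L) (hS : Smooth_cm L ι H T hT Smooth p) (hTr : Transfer_cm L ι H T hT Transfer p f)
    (hTH : TransferH_cm L ι H T hT Smooth TransferH p fH) : MatchH_cm L ι H T hT Smooth Transfer TransferH f fH :=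
  ⟨p, hS, hTr, hTH⟩

end DatumOfRecordCM

end Summit.HodgeConjecture.HodgeConjecture.R90.S9

end
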